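import Literature.MathematicalPhysics.QuantumManyBody.WeightedCorrector
import HarnessLib

/-!
# Crux `CorrectorClosure` (stmt-AtomisticToContinuum-12058), line `healing-scale-kac-insertion` —
registered stub `stub_firstCorrector` (the recoil lemma)

Supports (does not close) stmt-AtomisticToContinuum-12058, route `BECInsertionCorrector`.
The registered stub 5 of the lead's skeleton
`Cruxes/CorrectorClosure/Lines/healing-scale-kac-insertion.lean`, in the weighted-corrector
vocabulary of `Literature/MathematicalPhysics/QuantumManyBody/WeightedCorrector.lean` (weight `Θ`
on the `M`-particle torus of side `L`, Dirichlet form `𝓔_Θ = dirichletFormW L Θ`, Kipnis–Varadhan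
norm `‖·‖²₋₁ = hMinusOneSqW L Θ`).

**Statement.** If a periodic test function `ξ` solves the *massive* corrector equation
`(-G_Θ + q) ξ = a` weakly, `𝓔_Θ(ξ, φ) + q ∫ ξ φ Θ² = ∫ a φ Θ²` for every periodic test `φ`, with
mass `q > 0`, then `4 q ∫ ξ² Θ² ≤ ‖a‖²₋₁` — the operator inequality `(ω + q)⁻² ≤ (4 ω q)⁻¹`
(AM–GM) read through the variational formula for the `H₋₁` norm. In the line `q = |p|²` is the
recoil of the tagged particle in the `y`-Fourier mode `p`, and the lemma makes the first Kac
corrector `L²`-bounded uniformly in the box; the heart `stub_kacClosure` consumes it verbatim.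

**Proof.** Put `e = 𝓔_Θ(ξ, ξ) ≥ 0`, `Q = ∫ ξ² Θ² ≥ 0`, `P = ∫ a ξ Θ²`; the equation at `φ = ξ`
reads `e + q Q = P`. Testing the variational supremum against `λ ξ` (`le_hMinusOneSqW`,
`IsPeriodicTest.smul`, bilinearity) gives `2 λ P - λ² e ≤ ‖a‖²₋₁` for every real `λ`. If `e > 0`
take `λ = P / e`: `P² / e = (e + q Q)² / e ≥ 4 q Q`. If `e = 0` then `P = q Q` and
`2 λ q Q ≤ ‖a‖²₋₁` for all `λ`, so either `Q = 0` (trivial) or `‖a‖²₋₁ = ⊤`. No side condition on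
`Θ`, `a`, `L` is needed: the equation hands over the value of `P`, and `e, Q ≥ 0` always.
The real-variable core is isolated as `ofReal_four_mul_le_of_forall_test`.
-/

noncomputable section

open MeasureTheory
open scoped ENNReal NNReal

namespace Summit.AtomisticToContinuum.BoseEinsteinCondensation.Theorems.CorrectorClosure.HealingScaleKacInsertion

open Literature.MathematicalPhysics.QuantumManyBody.BoseGas

/-- **The scalar core of the recoil lemma.** If `e, Q ≥ 0`, `q > 0`, `e + q Q = P` and an extended
real `x` dominates `2 λ P - λ² e` (truncated at `0`) for every real `λ`, then `4 q Q ≤ x`: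
for `e > 0` optimise at `λ = P / e` and use `(e + q Q)² ≥ 4 e q Q`; for `e = 0` the linear
functions `λ ↦ 2 λ q Q` are bounded by `x`, forcing `Q = 0` or `x = ⊤`. [folklore] -/
theorem ofReal_four_mul_le_of_forall_test {e Q P q : ℝ} {x : ℝ≥0∞} (hq : 0 < q) (he : 0 ≤ e)
    (hQ : 0 ≤ Q) (hPeq : e + q * Q = P)
    (hvar : ∀ lam : ℝ, ENNReal.ofReal (2 * lam * P - lam ^ 2 * e) ≤ x) :
    ENNReal.ofReal (4 * q * Q) ≤ x := by
  rcases he.lt_or_eq with hepos | hezero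
  · -- `e > 0`: test at `λ = P / e`, where `2λP - λ²e = P²/e ≥ 4qQ` by AM–GM
    refine (ENNReal.ofReal_le_ofReal ?_).trans (hvar (P / e))
    have hene : e ≠ 0 := hepos.ne'
    have h1 : 2 * (P / e) * P - (P / e) ^ 2 * e = P ^ 2 / e := by
      field_simp
      ring
    rw [h1, le_div_iff₀ hepos, ← hPeq]
    nlinarith [sq_nonneg (e - q * Q), hq, hQ]
  · -- `e = 0`: `P = q Q` and `2 λ q Q ≤ x` for every `λ`
    subst hezero
    have hPQ : P = q * Q := by linarith
    subst hPQ
    rcases hQ.lt_or_eq with hQpos | hQzero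
    · have hq0 : q ≠ 0 := hq.ne'
      have hQ0 : Q ≠ 0 := hQpos.ne'
      have htop : x = ⊤ := by
        refine ENNReal.eq_top_of_forall_nnreal_le fun r => ?_
        have h := hvar ((r : ℝ) / (2 * (q * Q)))
        rwa [mul_zero, sub_zero,
          show 2 * ((r : ℝ) / (2 * (q * Q))) * (q * Q) = r by field_simp,
          ENNReal.ofReal_coe_nnreal] at h
      rw [htop]
      exact le_top
    · subst hQzero
      rw [mul_zero, ENNReal.ofReal_zero]
      exact bot_le

/-- **Registered stub 5 of line `healing-scale-kac-insertion` — the recoil lemma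
`(ω + q)⁻² ≤ (4 ω q)⁻¹`.** In the weighted-corrector vocabulary (weight `Θ` on the `M`-particle
torus of side `L`): if a periodic test function `ξ` solves the massive corrector equation
`(-G_Θ + q) ξ = a` weakly, i.e. `𝓔_Θ(ξ, φ) + q ∫ ξ φ Θ² = ∫ a φ Θ²` for every periodic test `φ`,
with mass `q > 0`, then `4 q ∫_{[0,L)^{3M}} ξ² Θ² ≤ ‖a‖²_{H₋₁(G_Θ)}`. Proof: test `hMinusOneSqW`
against `λ ξ` and optimise in `λ` (`ofReal_four_mul_le_of_forall_test`). No hypothesis on `Θ`, `a`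
or `L` (junk Bochner integrals are harmless: the equation at `φ = ξ` hands over the value of
`∫ a ξ Θ²`). [folklore] -/
theorem stub_firstCorrector :
    ∀ (M : ℕ) (L : ℝ) (Θ : Config M → ℝ) (q : ℝ), 0 < q → ∀ (a ξ : Config M → ℝ),
      IsPeriodicTest L ξ →
      (∀ φ : Config M → ℝ, IsPeriodicTest L φ →
        dirichletFormW L Θ ξ φ + q * ∫ X in cellN M L, ξ X * φ X * Θ X ^ 2 =
          ∫ X in cellN M L, a X * φ X * Θ X ^ 2) →
      ENNReal.ofReal (4 * q * ∫ X in cellN M L, ξ X ^ 2 * Θ X ^ 2) ≤ hMinusOneSqW L Θ a := by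
  intro M L Θ q hq a ξ hξ heq
  -- `e = 𝓔_Θ(ξ, ξ) ≥ 0` and `Q = ∫ ξ² Θ² ≥ 0`
  have he : 0 ≤ dirichletFormW L Θ ξ ξ := dirichletFormW_self_nonneg L Θ ξ
  have hQ : 0 ≤ ∫ X in cellN M L, ξ X ^ 2 * Θ X ^ 2 :=
    integral_nonneg fun X => mul_nonneg (sq_nonneg _) (sq_nonneg _)
  -- the equation at `φ = ξ`: `e + q Q = P`
  have hPeq : dirichletFormW L Θ ξ ξ + q * ∫ X in cellN M L, ξ X ^ 2 * Θ X ^ 2 =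
      ∫ X in cellN M L, a X * ξ X * Θ X ^ 2 := by
    have h2 : ∫ X in cellN M L, ξ X * ξ X * Θ X ^ 2 = ∫ X in cellN M L, ξ X ^ 2 * Θ X ^ 2 :=
      integral_congr_ae (ae_of_all _ fun X => by ring)
    rw [← h2]
    exact heq ξ hξ
  -- the variational bound tested against `λ ξ`: `2 λ P - λ² e ≤ ‖a‖²₋₁`
  have hvar : ∀ lam : ℝ,
      ENNReal.ofReal (2 * lam * (∫ X in cellN M L, a X * ξ X * Θ X ^ 2) -
        lam ^ 2 * dirichletFormW L Θ ξ ξ) ≤ hMinusOneSqW L Θ a := by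
    intro lam
    have h := le_hMinusOneSqW L Θ a (hξ.smul lam)
    rw [integral_mul_smul_mul_sq, dirichletFormW_smul_left, dirichletFormW_smul_right] at h
    convert h using 2
    ring
  exact ofReal_four_mul_le_of_forall_test hq he hQ hPeq hvar

end Summit.AtomisticToContinuum.BoseEinsteinCondensation.Theorems.CorrectorClosure.HealingScaleKacInsertion

end
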